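import Summits.PneNP.PneNP.Theorems.ChebyshevTracialDesignPairContainmentAverage
import Summits.PneNP.PneNP.Theorems.ChebyshevTracialDesignPseudoMatchingBaseTransport
import HarnessLib

/-!
# Cell pnp-psdrank, route `ChebyshevTracialDesign`: LOW MATCHING-DEGREE DIRECTION FIELDS ARE FREE FOR EVERY MASK — the pair-containment
# form summed over the matchings is `≤ 0` EXACTLY in every `M`-DEPENDENT direction field of matching-degree `≤ j` (`2(j+1) ≤ D`), in particular
# over the STAR of every small partial pattern and for every window-LOCAL field (crux `TracialDecayExp20`, stmt-PneNP-19878)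

Brick 164 (prover g32). (CG_1') — the kernel-exact residue of the amplitude-one rung of the crux (MEMO-21 §3(c'), bricks 98–108) — asks
`Σ_M sup_{|v_M| ≤ 1} (Σ_U W(U,M) f(U) C_{v_M}(U)²)₊ ≤ e^{−a·dq n}` for masks `f : t-cuts → [0,1]`, with the pair-containment form
`C_v(U) = Σ_p v_p x_p x_{π_M p}` (`x_p = 1[p ∈ U]`, `π_M` the partner map). Its two difficulties are the positive part and the `M`-DEPENDENCE of the
direction. Brick 104 (`…PairContainmentAverage.sum_containment_sq_nonpos_of_fixed`) removed both at once: for a direction NOT depending on `M`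
the `M`-sum is `≤ 0` exactly, for every `f ≥ 0`. The mask programme since (bricks 113–163) priced ALL directions for STRUCTURED masks (juntas on
`≤ n^{5/8}/10` coordinates). This file is the dual slice: ALL masks, STRUCTURED `M`-dependence of the direction.
* §1 `mul_edgeIndicator_mem_span` — matching-degree bookkeeping: a function of matching-degree `≤ j` times one edge indicator `1[e ∈ M]` has
  matching-degree `≤ j+1` (`1[F ⊆ M]·1[e ∈ M] = 1[insert e F ⊆ M]`).
* §2 **`sum_containment_sq_nonpos_of_lowDegreeField`** — `n` even, `(C, w)` an exact design of degree `D` on the `t`-cuts, `f ≥ 0` ANY mask (no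
  upper bound, no structure), `v : PMatch n → (Fin n → ℝ)` ANY direction field each of whose coordinates `M ↦ v_M(p)` has matching-degree `≤ j`
  (lies in the span of the monomials `1[F ⊆ M]`, `|F| ≤ j`), with `2(j+1) ≤ D`, `6(j+1)+1 ≤ t`, `6(j+1)+1 ≤ n−t`, and NO size bound on `v`:
  `Σ_U Σ_M W(U,M) f(U) C_{v_M}(U)² ≤ 0`. MECHANISM (brick 104's, with the `M`-dependence moved to the matching side): `C_{v_M}(U) =
  Σ_{(a,b)} (x_a x_b)(U)·(v_M(a)·1[{a,b} ∈ M])` pairs a cut-side vector with a matching-side vector of matching-degree `≤ j+1` (§1), so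
  `f(U)·C_{v_M}(U)² = tr(X_U B_M B_Mᵀ)` with `X_U = f(U)·α_Uα_Uᵀ ⪰ 0` and `B` of matching-degree `≤ j+1`, priced `≤ 0` by the tree's UNCONDITIONAL
  matching-side low-degree theorem `…PseudoMatchingBaseTransport.sum_levelWeight_trace_nonpos_of_lowDegreeM` (Potechin's story pseudo-expectation,
  base certificate at `6k+1`). Brick 104 is the case `j = 0`.
* §3 **`sum_star_containment_sq_nonpos`** — PINNED STARS: for every edge set `S` with `|S| ≤ j` and every FIXED direction `u`,
  `Σ_U Σ_{M ⊇ S} W(U,M) f(U) C_u(U)² ≤ 0` (the field `1[S ⊆ M]·u` has degree `|S|`); `star_containment_sq_nonpos_at` — the PER-CUT form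
  (`f = δ_{U₀}`): `Σ_{M ⊇ S} W(U₀,M) C_u^M(U₀)² ≤ 0` at EVERY cut `U₀`. With `S = ∅` these are brick 104 / brick 105's per-cut identity.
* §4 **`sum_containment_sq_nonpos_of_local`** — WINDOW-LOCAL FIELDS: if `v_M` depends on `M` only through the partners of the vertices of a window
  `H` (`v_M = v_{M'}` whenever `π_M = π_{M'}` on `H`) and `2(|H|+1) ≤ D`, `6(|H|+1)+1 ≤ t, n−t`, then `Σ_U Σ_M W f C_{v_M}² ≤ 0` for every `f ≥ 0`
  (a local field has matching-degree `≤ |H|`: `v_M(p) = Σ_{M₀} (v_{M₀}(p)/N(M₀))·1[S_H(M₀) ⊆ M]`, `S_H(M₀)` the `M₀`-edges at `H`, §4's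
  `local_mem_span`).
READING (MEMO-35 §1). Since `v_M` may be chosen independently for each `M`, the literal (CG_1') for the whole mask class `0 ≤ f ≤ G` is EQUIVALENT to
the mask-free per-cut statement «`Σ_U (Σ_M W(U,M) C_{v_M}(U)²)₊ ≤ ε/G` for every field `|v_M| ≤ 1`» (brick 165); by §3 that per-cut quantity is
`≤ 0` AT EVERY CUT as long as the field reads `≤ D/2 − 1` local bits of `M` (and by brick 105 when it reads none). What is left of the amplitude-one
rung is therefore per-cut virtual nonpositivity for fields that are GLOBAL functions of the matching (e.g. adapted to `cc(U₀, M)`, MEMO-34 §8(i)).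
[cite: Potechin2019, Thm. 1.2 (LIPIcs 124, 61:4)] [cite: Grigoriev2001, Lemma 1.4 (PDF p. 8)] [cite: Rothvoss2017, §2 (PDF p. 6)]
[cite: GriblingDelaatLaurent2019, §5]
Stature: support/instrument (kernel lane, no defs, axioms standard; an EXACT theorem on a sub-class of direction fields). WHAT THIS IS NOT: nothing on
`M`-global direction fields (that is the open part of (CG_1')), no proof or refutation of `TracialDecayExp20`, nothing on psd rank of P_PM(K_n)
beyond the rungs, no P-vs-NP content. Supports stmt-PneNP-19878.
-/

set_option linter.dupNamespace false -- `Summit.PneNP.PneNP.…`: summit = sub-problem (D-0017)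

noncomputable section

namespace Summit.PneNP.PneNP.Theorems.ChebyshevTracialDesignPairContainmentLowDegreeFields

open Finset Matrix Literature.Barriers.PneNP Literature.Combinatorics.Optimization
open Summit.PneNP.PneNP.Theorems.ChebyshevTracialDesignPseudoMatchingBaseTransport (sum_levelWeight_trace_nonpos_of_lowDegreeM)
open Summit.PneNP.PneNP.Theorems.ChebyshevTracialDesignPairContainmentAverage (containment_eq_pairing)

variable {n : ℕ}

/-! ### §1 Matching-degree bookkeeping -/

/-- **One more edge indicator raises the matching-degree by at most one**: if `g` lies in the span of the monomials `M ↦ 1[F ⊆ M]`, `|F| ≤ j`,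
then `M ↦ g(M)·1[e ∈ M]` lies in the span of the monomials with `|F| ≤ j+1` (`1[F ⊆ M]·1[e ∈ M] = 1[insert e F ⊆ M]`).
[cite: LeeRaghavendraSteurer2015, §5] -/
theorem mul_edgeIndicator_mem_span {j : ℕ} {g : PMatch n → ℝ}
    (hg : g ∈ Submodule.span ℝ (Set.range fun F : {F : Finset (Sym2 (Fin n)) // F.card ≤ j} =>
      fun M : PMatch n => if F.1 ⊆ M.1 then (1 : ℝ) else 0)) (e : Sym2 (Fin n)) :
    (fun M : PMatch n => g M * (if e ∈ M.1 then (1 : ℝ) else 0)) ∈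
      Submodule.span ℝ (Set.range fun F : {F : Finset (Sym2 (Fin n)) // F.card ≤ j + 1} =>
        fun M : PMatch n => if F.1 ⊆ M.1 then (1 : ℝ) else 0) := by
  classical
  induction hg using Submodule.span_induction with
  | mem x hx =>
    obtain ⟨F, rfl⟩ := hx
    refine Submodule.subset_span ⟨⟨insert e F.1, (Finset.card_insert_le _ _).trans (by simpa using F.2)⟩, ?_⟩
    funext M
    simp only [Finset.insert_subset_iff]
    by_cases h1 : e ∈ M.1 <;> by_cases h2 : F.1 ⊆ M.1 <;> simp [h1, h2]
  | zero =>
    have : (fun M : PMatch n => (0 : PMatch n → ℝ) M * (if e ∈ M.1 then (1 : ℝ) else 0)) = 0 := by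
      funext M; simp
    rw [this]; exact Submodule.zero_mem _
  | add x y hx hy ihx ihy =>
    have : (fun M : PMatch n => (x + y) M * (if e ∈ M.1 then (1 : ℝ) else 0)) =
        (fun M => x M * (if e ∈ M.1 then (1 : ℝ) else 0)) + (fun M => y M * (if e ∈ M.1 then (1 : ℝ) else 0)) := by
      funext M; simp only [Pi.add_apply]; ring
    rw [this]; exact Submodule.add_mem _ ihx ihy
  | smul a x hx ihx =>
    have : (fun M : PMatch n => (a • x) M * (if e ∈ M.1 then (1 : ℝ) else 0)) =
        a • (fun M => x M * (if e ∈ M.1 then (1 : ℝ) else 0)) := by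
      funext M; simp only [Pi.smul_apply, smul_eq_mul]; ring
    rw [this]; exact Submodule.smul_mem _ a ihx

/-- A scalar multiple of one monomial `1[S ⊆ M]` with `|S| ≤ j` has matching-degree `≤ j`. [cite: LeeRaghavendraSteurer2015, §5] -/
theorem smul_indicator_mem_span {j : ℕ} (S : Finset (Sym2 (Fin n))) (hS : S.card ≤ j) (c : ℝ) :
    (fun M : PMatch n => c * (if S ⊆ M.1 then (1 : ℝ) else 0)) ∈
      Submodule.span ℝ (Set.range fun F : {F : Finset (Sym2 (Fin n)) // F.card ≤ j} =>
        fun M : PMatch n => if F.1 ⊆ M.1 then (1 : ℝ) else 0) := by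
  have h : (fun M : PMatch n => c * (if S ⊆ M.1 then (1 : ℝ) else 0)) =
      c • (fun M : PMatch n => if S ⊆ M.1 then (1 : ℝ) else 0) := by
    funext M; simp
  rw [h]
  exact Submodule.smul_mem _ c (Submodule.subset_span ⟨⟨S, hS⟩, rfl⟩)

/-! ### §2 The pair-containment form in a low matching-degree direction field -/

/-- **LOW MATCHING-DEGREE DIRECTION FIELDS ARE FREE, FOR EVERY MASK.** Let `n` be even, `(C, w)` an exact design of degree `D` on the `t`-cuts,
`f : cuts → ℝ_{≥0}` ANY nonnegative mask and `v : PMatch n → (Fin n → ℝ)` a direction FIELD each of whose coordinates `M ↦ v_M(p)` has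
matching-degree `≤ j` (span of `1[F ⊆ M]`, `|F| ≤ j`), where `2(j+1) ≤ D`, `6(j+1)+1 ≤ t` and `6(j+1)+1 ≤ n − t` (no bound on the size of `v`).
Then `Σ_U Σ_M W(U,M)·f(U)·(Σ_p v_M(p) x_p x_{π_M p})² ≤ 0`. (Brick 104 is `j = 0`.)
[cite: Potechin2019, Thm. 1.2 (LIPIcs 124, 61:4)] [cite: Grigoriev2001, Lemma 1.4 (PDF p. 8)] [cite: Rothvoss2017, §2 (PDF p. 6)] -/
theorem sum_containment_sq_nonpos_of_lowDegreeField (hn : Even n) {t T D : ℕ} {Bv : ℝ} {C : Finset ℕ} {w : ℕ → ℝ}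
    (hdes : IsExactDesign n t T D Bv C w) {j : ℕ} (hjD : 2 * (j + 1) ≤ D) (hjt : 6 * (j + 1) + 1 ≤ t)
    (hjnt : 6 * (j + 1) + 1 ≤ n - t) (f : OddSet n → ℝ) (hf : ∀ U, 0 ≤ f U) (v : PMatch n → Fin n → ℝ)
    (hv : ∀ p, (fun M : PMatch n => v M p) ∈ Submodule.span ℝ (Set.range fun F : {F : Finset (Sym2 (Fin n)) // F.card ≤ j} =>
      fun M : PMatch n => if F.1 ⊆ M.1 then (1 : ℝ) else 0)) :
    ∑ U : OddSet n, ∑ M : PMatch n, levelWeight n t C w U M *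
      (f U * (∑ p, v M p * ((if p ∈ U.1 then (1 : ℝ) else 0) * (if M.2.partner p ∈ U.1 then (1 : ℝ) else 0))) ^ 2) ≤ 0 := by
  classical
  -- the cut-side vectors (pair indicators) and the matching-side vectors (direction × edge indicator), indexed by ordered pairs
  set α : OddSet n → Fin (n * n) → ℝ := fun U i =>
    (if (finProdFinEquiv.symm i).1 ∈ U.1 then (1 : ℝ) else 0) * (if (finProdFinEquiv.symm i).2 ∈ U.1 then (1 : ℝ) else 0) with hα
  set β : PMatch n → Fin (n * n) → ℝ := fun M i => v M (finProdFinEquiv.symm i).1 *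
    (if s((finProdFinEquiv.symm i).1, (finProdFinEquiv.symm i).2) ∈ M.1 then (1 : ℝ) else 0) with hβ
  have hdot : ∀ (U : OddSet n) (M : PMatch n), ∑ i, α U i * β M i =
      ∑ p, v M p * ((if p ∈ U.1 then (1 : ℝ) else 0) * (if M.2.partner p ∈ U.1 then (1 : ℝ) else 0)) := by
    intro U M
    rw [containment_eq_pairing U M (v M)]
    refine sum_congr rfl fun i _ => ?_
    simp only [hα, hβ]
    ring
  set X : OddSet n → Matrix (Fin (n * n)) (Fin (n * n)) ℝ := fun U => f U • vecMulVec (α U) (α U) with hX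
  set B : PMatch n → Matrix (Fin (n * n)) (Fin 1) ℝ := fun M => Matrix.of fun i _ => β M i with hB
  have hXpsd : ∀ U, (X U).PosSemidef := fun U => by
    have h := posSemidef_vecMulVec_self_star (α U)
    rw [star_trivial] at h
    exact h.smul (hf U)
  have hBlow : IsLowDegreeM n (j + 1) B := fun i _ => by
    change (fun M : PMatch n => β M i) ∈ _
    exact mul_edgeIndicator_mem_span (hv _) _
  have htr : ∀ (U : OddSet n) (M : PMatch n), (X U * (B M * (B M)ᵀ)).trace = f U * (∑ i, α U i * β M i) ^ 2 := by
    intro U M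
    simp only [hX, hB, Matrix.trace, Matrix.diag_apply, Matrix.mul_apply, Matrix.transpose_apply, Matrix.smul_apply, vecMulVec_apply,
      Matrix.of_apply, smul_eq_mul, Fin.sum_univ_one]
    rw [sq, sum_mul_sum, mul_sum]
    refine sum_congr rfl fun i _ => ?_
    rw [mul_sum]
    refine sum_congr rfl fun i' _ => ?_
    ring
  have h := sum_levelWeight_trace_nonpos_of_lowDegreeM hn hdes (k := j + 1) hjD hjt hjnt X hXpsd B hBlow
  simp_rw [htr, hdot] at h
  exact h

/-- The same with the sums in the order `Σ_M Σ_U`. [cite: Potechin2019, Thm. 1.2 (LIPIcs 124, 61:4)] -/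
theorem sum_containment_sq_nonpos_of_lowDegreeField' (hn : Even n) {t T D : ℕ} {Bv : ℝ} {C : Finset ℕ} {w : ℕ → ℝ}
    (hdes : IsExactDesign n t T D Bv C w) {j : ℕ} (hjD : 2 * (j + 1) ≤ D) (hjt : 6 * (j + 1) + 1 ≤ t)
    (hjnt : 6 * (j + 1) + 1 ≤ n - t) (f : OddSet n → ℝ) (hf : ∀ U, 0 ≤ f U) (v : PMatch n → Fin n → ℝ)
    (hv : ∀ p, (fun M : PMatch n => v M p) ∈ Submodule.span ℝ (Set.range fun F : {F : Finset (Sym2 (Fin n)) // F.card ≤ j} =>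
      fun M : PMatch n => if F.1 ⊆ M.1 then (1 : ℝ) else 0)) :
    ∑ M : PMatch n, ∑ U : OddSet n, levelWeight n t C w U M *
      (f U * (∑ p, v M p * ((if p ∈ U.1 then (1 : ℝ) else 0) * (if M.2.partner p ∈ U.1 then (1 : ℝ) else 0))) ^ 2) ≤ 0 := by
  rw [sum_comm]; exact sum_containment_sq_nonpos_of_lowDegreeField hn hdes hjD hjt hjnt f hf v hv

/-! ### §3 Pinned stars: the form summed over `{M ⊇ S}` in a fixed direction, and the per-cut form -/

/-- **PINNED STARS ARE NONPOSITIVE IN EVERY FIXED DIRECTION, FOR EVERY MASK.** Let `n` be even, `(C, w)` an exact design of degree `D` on the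
`t`-cuts, `S` any edge set with `|S| ≤ j`, `2(j+1) ≤ D`, `6(j+1)+1 ≤ t`, `6(j+1)+1 ≤ n − t`, `f ≥ 0` any mask and `u : Fin n → ℝ` any direction.
Then `Σ_U Σ_{M ⊇ S} W(U,M)·f(U)·(Σ_p u_p x_p x_{π_M p})² ≤ 0` (the direction field `1[S ⊆ M]·u` has matching-degree `|S|`; for `S = ∅` this is
brick 104). [cite: Potechin2019, Thm. 1.2 (LIPIcs 124, 61:4)] [cite: Grigoriev2001, Lemma 1.4 (PDF p. 8)] [cite: Rothvoss2017, §2 (PDF p. 6)] -/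
theorem sum_star_containment_sq_nonpos (hn : Even n) {t T D : ℕ} {Bv : ℝ} {C : Finset ℕ} {w : ℕ → ℝ}
    (hdes : IsExactDesign n t T D Bv C w) {j : ℕ} (hjD : 2 * (j + 1) ≤ D) (hjt : 6 * (j + 1) + 1 ≤ t)
    (hjnt : 6 * (j + 1) + 1 ≤ n - t) (S : Finset (Sym2 (Fin n))) (hS : S.card ≤ j)
    (f : OddSet n → ℝ) (hf : ∀ U, 0 ≤ f U) (u : Fin n → ℝ) :
    ∑ U : OddSet n, ∑ M ∈ (univ : Finset (PMatch n)).filter (fun M => S ⊆ M.1), levelWeight n t C w U M *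
      (f U * (∑ p, u p * ((if p ∈ U.1 then (1 : ℝ) else 0) * (if M.2.partner p ∈ U.1 then (1 : ℝ) else 0))) ^ 2) ≤ 0 := by
  classical
  have h := sum_containment_sq_nonpos_of_lowDegreeField hn hdes hjD hjt hjnt f hf
    (fun M p => (if S ⊆ M.1 then (1 : ℝ) else 0) * u p) (fun p => by
      have := smul_indicator_mem_span (n := n) S hS (u p)
      refine (congrArg (· ∈ _) ?_).mp this
      funext M; ring)
  refine le_of_eq_of_le ?_ h
  refine sum_congr rfl fun U _ => ?_
  rw [sum_filter]
  refine sum_congr rfl fun M _ => ?_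
  by_cases hSM : S ⊆ M.1
  · simp only [hSM, if_true, one_mul]
  · simp only [hSM, if_false, zero_mul, sum_const_zero]
    ring

/-- The same with the sums in the order `Σ_{M ⊇ S} Σ_U`. [cite: Potechin2019, Thm. 1.2 (LIPIcs 124, 61:4)] -/
theorem sum_star_containment_sq_nonpos' (hn : Even n) {t T D : ℕ} {Bv : ℝ} {C : Finset ℕ} {w : ℕ → ℝ}
    (hdes : IsExactDesign n t T D Bv C w) {j : ℕ} (hjD : 2 * (j + 1) ≤ D) (hjt : 6 * (j + 1) + 1 ≤ t)
    (hjnt : 6 * (j + 1) + 1 ≤ n - t) (S : Finset (Sym2 (Fin n))) (hS : S.card ≤ j)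
    (f : OddSet n → ℝ) (hf : ∀ U, 0 ≤ f U) (u : Fin n → ℝ) :
    ∑ M ∈ (univ : Finset (PMatch n)).filter (fun M => S ⊆ M.1), ∑ U : OddSet n, levelWeight n t C w U M *
      (f U * (∑ p, u p * ((if p ∈ U.1 then (1 : ℝ) else 0) * (if M.2.partner p ∈ U.1 then (1 : ℝ) else 0))) ^ 2) ≤ 0 := by
  rw [sum_comm]; exact sum_star_containment_sq_nonpos hn hdes hjD hjt hjnt S hS f hf u

/-- **THE PER-CUT FORM: at EVERY cut, the pair-containment form summed over a small pinned star is `≤ 0` in every fixed direction** —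
`Σ_{M ⊇ S} W(U₀,M)·(Σ_p u_p x_p(U₀) x_{π_M p}(U₀))² ≤ 0` for every `t`-cut (indeed every odd cut) `U₀`, every edge set `|S| ≤ j` with
`2(j+1) ≤ D`, `6(j+1)+1 ≤ t, n−t`, and every `u` (the mask `f = δ_{U₀}` in `sum_star_containment_sq_nonpos`). For `S = ∅` this is the per-cut
identity behind brick 105 (`…PairContainmentMean.sum_containment_sq_eq_linear`: the value is `−L_u(U₀)²/#t-cuts`).
[cite: Potechin2019, Thm. 1.2 (LIPIcs 124, 61:4)] [cite: Rothvoss2017, §2 (PDF p. 6)] -/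
theorem star_containment_sq_nonpos_at (hn : Even n) {t T D : ℕ} {Bv : ℝ} {C : Finset ℕ} {w : ℕ → ℝ}
    (hdes : IsExactDesign n t T D Bv C w) {j : ℕ} (hjD : 2 * (j + 1) ≤ D) (hjt : 6 * (j + 1) + 1 ≤ t)
    (hjnt : 6 * (j + 1) + 1 ≤ n - t) (S : Finset (Sym2 (Fin n))) (hS : S.card ≤ j) (U₀ : OddSet n) (u : Fin n → ℝ) :
    ∑ M ∈ (univ : Finset (PMatch n)).filter (fun M => S ⊆ M.1), levelWeight n t C w U₀ M *
      (∑ p, u p * ((if p ∈ U₀.1 then (1 : ℝ) else 0) * (if M.2.partner p ∈ U₀.1 then (1 : ℝ) else 0))) ^ 2 ≤ 0 := by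
  classical
  have h := sum_star_containment_sq_nonpos' hn hdes hjD hjt hjnt S hS (fun U => if U = U₀ then (1 : ℝ) else 0)
    (fun U => by positivity) u
  refine le_of_eq_of_le ?_ h
  refine sum_congr rfl fun M _ => ?_
  rw [eq_comm, Finset.sum_eq_single U₀ (fun U _ hU => by simp [hU]) (fun hU => absurd (mem_univ _) hU)]
  simp

/-! ### §4 Window-local direction fields -/

/-- The edges of a perfect matching at a window `H` (`S_H(M) = {{h, π_M h} : h ∈ H}`) number at most `|H|`. [folklore] -/
theorem card_localEdges_le (M : PMatch n) (H : Finset (Fin n)) :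
    (H.image fun h => s(h, M.2.partner h)).card ≤ H.card :=
  Finset.card_image_le

/-- `S_H(M₀) ⊆ M` iff `M` and `M₀` have the same partners on `H`. [folklore] -/
theorem localEdges_subset_iff (M₀ M : PMatch n) (H : Finset (Fin n)) :
    (H.image fun h => s(h, M₀.2.partner h)) ⊆ M.1 ↔ ∀ h ∈ H, M.2.partner h = M₀.2.partner h := by
  classical
  constructor
  · intro hsub h hh
    have hmem : s(h, M₀.2.partner h) ∈ M.1 := hsub (Finset.mem_image.2 ⟨h, hh, rfl⟩)
    exact (M.2.eq_partner_of_mem hmem).symm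
  · intro heq e he
    obtain ⟨h, hh, rfl⟩ := Finset.mem_image.1 he
    rw [← heq h hh]
    exact M.2.mk_partner_mem h

/-- **A window-local field has matching-degree at most the window size.** If `g : PMatch n → ℝ` satisfies `g M = g M'` whenever `M` and `M'`
have the same partners on `H`, then `g` lies in the span of the monomials `1[F ⊆ M]` with `|F| ≤ |H|`: explicitly
`g = Σ_{M₀} (g(M₀)/N(M₀))·1[S_H(M₀) ⊆ ·]` with `N(M₀)` the number of matchings agreeing with `M₀` on `H`. [cite: LeeRaghavendraSteurer2015, §5] -/
theorem local_mem_span (H : Finset (Fin n)) (g : PMatch n → ℝ)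
    (hg : ∀ M M' : PMatch n, (∀ h ∈ H, M.2.partner h = M'.2.partner h) → g M = g M') :
    g ∈ Submodule.span ℝ (Set.range fun F : {F : Finset (Sym2 (Fin n)) // F.card ≤ H.card} =>
      fun M : PMatch n => if F.1 ⊆ M.1 then (1 : ℝ) else 0) := by
  classical
  -- the class size
  set N : PMatch n → ℝ := fun M₀ => (((univ : Finset (PMatch n)).filter fun M₁ => ∀ h ∈ H, M₁.2.partner h = M₀.2.partner h).card : ℝ)
    with hN
  have hNpos : ∀ M₀, 0 < N M₀ := fun M₀ => by
    simp only [hN]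
    exact_mod_cast Finset.card_pos.2 ⟨M₀, by simp⟩
  -- classes of equivalent matchings coincide
  have hNeq : ∀ M₀ M : PMatch n, (∀ h ∈ H, M.2.partner h = M₀.2.partner h) → N M₀ = N M := by
    intro M₀ M hMM₀
    simp only [hN]
    congr 2
    ext M₁
    simp only [mem_filter, mem_univ, true_and]
    exact ⟨fun h1 h hh => (h1 h hh).trans (hMM₀ h hh).symm, fun h1 h hh => (h1 h hh).trans (hMM₀ h hh)⟩
  -- the explicit expansion
  have hexp : g = ∑ M₀ : PMatch n, (g M₀ / N M₀) • (fun M : PMatch n =>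
      if (H.image fun h => s(h, M₀.2.partner h)) ⊆ M.1 then (1 : ℝ) else 0) := by
    funext M
    rw [Finset.sum_apply]
    simp only [Pi.smul_apply, smul_eq_mul, localEdges_subset_iff]
    rw [← Finset.sum_filter_add_sum_filter_not univ (fun M₀ : PMatch n => ∀ h ∈ H, M.2.partner h = M₀.2.partner h)]
    have h2 : ∑ M₀ ∈ univ.filter (fun M₀ : PMatch n => ¬ ∀ h ∈ H, M.2.partner h = M₀.2.partner h),
        g M₀ / N M₀ * (if ∀ h ∈ H, M.2.partner h = M₀.2.partner h then (1 : ℝ) else 0) = 0 :=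
      sum_eq_zero fun M₀ hM₀ => by rw [if_neg (mem_filter.1 hM₀).2, mul_zero]
    rw [h2, add_zero]
    have h1 : ∑ M₀ ∈ univ.filter (fun M₀ : PMatch n => ∀ h ∈ H, M.2.partner h = M₀.2.partner h),
        g M₀ / N M₀ * (if ∀ h ∈ H, M.2.partner h = M₀.2.partner h then (1 : ℝ) else 0) =
        ∑ M₀ ∈ univ.filter (fun M₀ : PMatch n => ∀ h ∈ H, M.2.partner h = M₀.2.partner h), g M / N M := by
      refine sum_congr rfl fun M₀ hM₀ => ?_
      have hc := (mem_filter.1 hM₀).2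
      rw [if_pos hc, mul_one, hg M₀ M (fun h hh => (hc h hh).symm), hNeq M₀ M hc]
    rw [h1, sum_const, nsmul_eq_mul]
    have hcard : (((univ : Finset (PMatch n)).filter fun M₀ : PMatch n => ∀ h ∈ H, M.2.partner h = M₀.2.partner h).card : ℝ) = N M := by
      simp only [hN]
      congr 2
      ext M₁
      simp only [mem_filter, mem_univ, true_and]
      exact ⟨fun h1 h hh => (h1 h hh).symm, fun h1 h hh => (h1 h hh).symm⟩
    rw [hcard, mul_div_cancel₀ _ (hNpos M).ne']
  rw [hexp]
  refine Submodule.sum_mem _ fun M₀ _ => Submodule.smul_mem _ _ (Submodule.subset_span ?_)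
  exact ⟨⟨H.image fun h => s(h, M₀.2.partner h), card_localEdges_le M₀ H⟩, rfl⟩

/-- **WINDOW-LOCAL DIRECTION FIELDS ARE FREE, FOR EVERY MASK.** Let `n` be even, `(C, w)` an exact design of degree `D` on the `t`-cuts, `H` a
window with `2(|H|+1) ≤ D`, `6(|H|+1)+1 ≤ t`, `6(|H|+1)+1 ≤ n − t`, `f ≥ 0` any mask, and `v : PMatch n → (Fin n → ℝ)` a direction field that
depends on the matching only through its partners on `H` (`v_M = v_{M'}` whenever `π_M = π_{M'}` on `H`; no size bound). Then
`Σ_U Σ_M W(U,M)·f(U)·(Σ_p v_M(p) x_p x_{π_M p})² ≤ 0`. [cite: Potechin2019, Thm. 1.2 (LIPIcs 124, 61:4)] [cite: Grigoriev2001, Lemma 1.4 (PDF p. 8)]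
[cite: Rothvoss2017, §2 (PDF p. 6)] -/
theorem sum_containment_sq_nonpos_of_local (hn : Even n) {t T D : ℕ} {Bv : ℝ} {C : Finset ℕ} {w : ℕ → ℝ}
    (hdes : IsExactDesign n t T D Bv C w) (H : Finset (Fin n)) (hHD : 2 * (H.card + 1) ≤ D) (hHt : 6 * (H.card + 1) + 1 ≤ t)
    (hHnt : 6 * (H.card + 1) + 1 ≤ n - t) (f : OddSet n → ℝ) (hf : ∀ U, 0 ≤ f U) (v : PMatch n → Fin n → ℝ)
    (hloc : ∀ M M' : PMatch n, (∀ h ∈ H, M.2.partner h = M'.2.partner h) → v M = v M') :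
    ∑ U : OddSet n, ∑ M : PMatch n, levelWeight n t C w U M *
      (f U * (∑ p, v M p * ((if p ∈ U.1 then (1 : ℝ) else 0) * (if M.2.partner p ∈ U.1 then (1 : ℝ) else 0))) ^ 2) ≤ 0 :=
  sum_containment_sq_nonpos_of_lowDegreeField hn hdes hHD hHt hHnt f hf v
    (fun p => local_mem_span H (fun M => v M p) (fun M M' hMM' => by rw [hloc M M' hMM']))

end Summit.PneNP.PneNP.Theorems.ChebyshevTracialDesignPairContainmentLowDegreeFields
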